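import Summits.BirchSwinnertonDyer.Rank1Residual.X11b.AnticyclotomicCoinvariants
import Summits.BirchSwinnertonDyer.Rank1Residual.X11b.WeakLeopoldt
import Summits.BirchSwinnertonDyer.Rank1Residual.X11b.RouteR1LocSurj
import Summits.BirchSwinnertonDyer.Rank1Residual.X11b.BDPRouteLocalKernelAtPPadic
import Summits.BirchSwinnertonDyer.Rank1Residual.X11b.LocalH2Transition
import Literature.NumberTheory.GaloisRepresentations.NumberFieldCdTwo
import HarnessLib

/-!
# X11b, route R1 — atom (L10) ELIMINATED from the statement of record: `BSD(E,p)` on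
# `R1Population` from the nine published facts, FOUR cited cohomological facts, the ONE typed
# Poitou–Tate shape (P6), (P11) off the locally-trivial pairs, and the one OPEN input

HONEST FRAMING (cell `b2b-bsdres`, run/shared/lean/b2b/bsd-rank1-residual/, verbatim in every
file): the goal of the cell is to DELETE the COMBINATION-SHAPED residual classes of the
Birch–Swinnerton-Dyer formula for ALL analytic-rank `≤ 1` elliptic curves over `ℚ` — "full BSD
formula for every rank `≤ 1` curve in class `C`" assembled STRICTLY from published theorems — so
that the rank-`≤ 1` remainder becomes exactly the CONSTRUCTION-SHAPED classes, which are TYPED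
(missing-input `Prop`s), NOT attempted. This is not "finishing BSD". Sub-cell
`b2b-bsdres-multr1-p1` (X11b, route R1 = Castella 2018 Thm. A re-proved along the author's
erratum); a RESEARCH ROUTE; no claim beyond the stated class; X11b stays CONSTRUCTION-SHAPED;
nothing here changes a label; no named fact is minted (one typed SHAPE `R1BaseSelmerCountAt` —
(P6) at every datum, nothing asserted — and theorems; no `sorry`). CONDITIONAL on the cited facts
`poitouTate_selmerStructure_duality`, `poitouTate_sha_tateDual`, `localEulerPoincareCharacteristic`,
`fieldCdLE_two_of_numberField`, taken as hypotheses, and on the ONE OPEN input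
`R1OpenInputOnTreeAt` ((IMC)∘(BDP), PREPRINT).

## What this file does

Gen 15's statement of record `R1.bsdp_of_onTree_twoAtoms_facts` took the TWO typed Poitou–Tate
shapes (P6) `BaseSelmerCountAt` and (L10) `CoinvariantsTrivialAt` at every datum.  This file
DISCHARGES (L10) (JSW17 Lemma 3.3.3) on route R1's data:

* `coinvariantsTrivialAt_of_erratum` — at a datum (erratum field `K`, `𝔭 ∣ p` of degree one, `γ` a
  topological generator, `Sel_v(K, E[p^∞])` finite at the primes above `p`):
  `CoinvariantsTrivialAt`, from weak Leopoldt `H²(K, E[p^∞]) = 0`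
  (`WeakLeopoldt.subsingleton_galoisCohomology_two_primary`)
  and the descent/surgery theorem `Coinv.coinvariantsTrivialAt_of_subsingleton`; the local
  `p`-power exponents come from `LocalH2Transition` (`v ∤ p`) and `K_v ≅ ℚ_p` (`v ∣ p`);
* `r1TwoAtomsAt_of_baseSelmerCount` — (P6) ∧ (L10) at every datum from (P6) alone;
* **`R1.bsdp_of_onTree_oneAtom_facts`** — the statement of record with ONE typed shape left.

References: [JetchevSkinnerWan2017] Lemma 3.3.3 (arXiv:1512.06894 pp. 11–12); [Castella2018] Thm.
2.3, §5; [Castella2018Erratum] Thm. 1.1, Thm. A′; [Harari2020] Thm. 17.13;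
[SerreGaloisCohomology1997] II §4.4 Prop. 13; [MilneADT2006] I Thm. 2.8, Thm. 4.10.
-/

noncomputable section

open scoped Classical

open WeierstrassCurve NumberField IsDedekindDomain Field
open Literature.NumberTheory.EllipticCurves Literature.NumberTheory.EllipticCurves.GreenbergSelmer
open Literature.NumberTheory.EllipticCurves.ModularForms
open Literature.NumberTheory.EllipticCurves.Rank1Residual
open Literature.NumberTheory.EllipticCurves.Rank1Residual.Typed
open Literature.NumberTheory.GaloisRepresentations
open Literature.NumberTheory.GaloisCohomology
open Summit.BirchSwinnertonDyer.Rank1Residual.X11b.AcSelmer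
open Summit.BirchSwinnertonDyer.Rank1Residual.X11b.LocBridge

namespace Summit.BirchSwinnertonDyer.Rank1Residual.X11b

/-! ## §1. The typed shape (P6) at every datum -/

section Defs

/-- **The ONE remaining Poitou–Tate atom of route R1 at every datum — PUB shape (P6)** (JSW17 Prop.
3.2.1 with (7.1.5) on the constructed objects), same quantifier prefix as `R1TwoAtomsAt`:
`BaseSelmerCountAt p 𝔭 (embAt K p 𝔭) P`. A predicate on `(W, p)`; nothing asserted; NOT a named
fact.
[cite: JetchevSkinnerWan2017, Prop. 3.2.1 (arXiv:1512.06894 p. 10) (shape only; nothing asserted)]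
[cite: Castella2018, Thm. 2.3 (arXiv:1704.06608 p. 5) (shape only; nothing asserted)] -/
def R1BaseSelmerCountAt (W : WeierstrassCurve ℚ) [W.IsElliptic] [W.IsGloballyMinimal] (p : ℕ)
    [Fact p.Prime] : Prop :=
  ∀ [NeZero (W.conductorNorm ℤ)] (q : ℕ) [Fact q.Prime] (K : Type) [Field K] [NumberField K]
    (Dt : ModularParametrizationData W (W.conductorNorm ℤ))
    (H : HeegnerDatum (W.conductorNorm ℤ) (NumberField.discr K)) (ι : K →+* ℂ)
    (P : (W.baseChange K).toAffine.Point),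
    ErratumHypotheses W p → W.analyticRank = 1 → q ≠ p → Mult W q →
    ¬ W.HasSplitMultiplicativeReductionAtPrime q → ¬ p ∣ padicValInt q W.minimalDiscriminantInt →
    IsErratumField W K q → Cas20Standing K p (W.conductorNorm ℤ / p) →
    WeierstrassCurve.Affine.Point.map ι.toRatAlgHom P = heegnerPointComplex Dt H →
    ¬ (p : ℤ) ∣ Dt.c → ¬ IsOfFinAddOrder P →
    ∀ (κ : ZpExtension K p), κ.IsAnticyclotomic →
      ∀ (γ : Field.absoluteGaloisGroup K) [Fact (κ.IsTopGenerator γ)] (𝔭 : HeightOneSpectrum (𝓞 K))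
        (h𝔭 : ((p : ℕ) : 𝓞 K) ∈ 𝔭.asIdeal) (he : 𝔭.asIdeal.ramificationIdx (𝓞 ℚ) = 1)
        (hf : 𝔭.asIdeal.inertiaDeg (𝓞 ℚ) = 1),
        BaseSelmerCountAt p 𝔭 (embAt K p 𝔭 h𝔭 he hf) P

end Defs

/-! ## §2. (L10) at a datum -/

section Atom

variable (W : WeierstrassCurve ℚ) [W.IsElliptic] [W.IsGloballyMinimal] (p : ℕ) [Fact p.Prime]

/-- A finite `p`-primary component gives a uniform `p`-power exponent. [folklore] -/
theorem exists_pow_nsmul_eq_zero_of_finite_primaryComponent {A : Type*} [AddCommGroup A]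
    [Finite (AddCommGroup.primaryComponent A p)] :
    ∃ e : ℕ, ∀ (j : ℕ) (Q : A), p ^ j • Q = 0 → p ^ e • Q = 0 := by
  have hp : p.Prime := Fact.out
  refine ⟨Nat.card (AddCommGroup.primaryComponent A p), fun j Q hQ ↦ ?_⟩
  have hmem : Q ∈ AddCommGroup.primaryComponent A p := AddCommGroup.mem_primaryComponent.mpr ⟨j, hQ⟩
  obtain ⟨t, -, ht⟩ := (Nat.dvd_prime_pow hp).mp (addOrderOf_dvd_of_nsmul_eq_zero hQ)
  have hdvd : addOrderOf Q ∣ Nat.card (AddCommGroup.primaryComponent A p) := by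
    have h1 := addOrderOf_dvd_natCard (⟨Q, hmem⟩ : AddCommGroup.primaryComponent A p)
    have h2 : addOrderOf ((AddCommGroup.primaryComponent A p).subtype ⟨Q, hmem⟩) =
        addOrderOf (⟨Q, hmem⟩ : AddCommGroup.primaryComponent A p) :=
      addOrderOf_injective _ Subtype.coe_injective _
    rw [← h2] at h1
    exact h1
  have hle : t ≤ Nat.card (AddCommGroup.primaryComponent A p) := by
    have h1 : p ^ t ≤ Nat.card (AddCommGroup.primaryComponent A p) :=
      Nat.le_of_dvd (Nat.card_pos) (ht ▸ hdvd)
    exact ((Nat.lt_pow_self hp.one_lt).le).trans h1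
  rw [← Nat.sub_add_cancel hle, pow_add, mul_smul, ← ht, addOrderOf_nsmul_eq_zero, smul_zero]

/-- **Uniform local `p`-power exponents of `E_K(K_v)`** for `E/ℚ` over an imaginary quadratic `K` in
which `p` splits: at `v ∤ p` by gen 15's `exists_pow_nsmul_rational_eq_zero`; at `v ∣ p` (degree
one) `E_K(K_v)[p^∞] ≅ E(ℚ_p)[p^∞]` is finite. [cite: GreenbergLNM1716, §3 Lemma 3.3 (p. 87)] -/
theorem exists_pow_nsmul_local_eq_zero {K : Type} [Field K] [NumberField K]
    (h2 : Module.finrank ℚ K = 2) (hs : SplitsIn K p) (v : HeightOneSpectrum (𝓞 K)) :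
    ∃ e : ℕ, ∀ (j : ℕ) (Q : ((W.baseChange K).baseChange (v.adicCompletion K)).toAffine.Point),
      p ^ j • Q = 0 → p ^ e • Q = 0 := by
  by_cases hv : ((p : ℕ) : 𝓞 K) ∈ v.asIdeal
  · obtain ⟨he, hf⟩ := degreeOne_of_splitsIn h2 hs hv
    haveI := (finite_and_natCard_primaryComponent_adicCompletion_eq_padic W p v hv he hf).1
    exact exists_pow_nsmul_eq_zero_of_finite_primaryComponent p
  · exact Levels.exists_pow_nsmul_rational_eq_zero (W.baseChange K) p v hv

/-- **(iv) in local form**: under the A′-hypotheses, at a degree-one `𝔭 ∣ p`, `E[p^∞]` has no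
`Γ_{K_𝔭}`-invariant point (indeed none under `D_𝔭 ∩ ker κ`,
`ErratumHypotheses.fixedPoints_decomp_inf_kerSubgroup_eq_bot`).
[cite: Castella2018Erratum, Thm. 1.1 (iv), Lemma 2.1 (pp. 1–2)] -/
theorem ErratumHypotheses.noInvariantsAt (hE : ErratumHypotheses W p) (K : Type) [Field K]
    [NumberField K] (κ : ZpExtension K p) (𝔭 : HeightOneSpectrum (𝓞 K))
    (h𝔭 : ((p : ℕ) : 𝓞 K) ∈ 𝔭.asIdeal) (he : 𝔭.asIdeal.ramificationIdx (𝓞 ℚ) = 1)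
    (hf : 𝔭.asIdeal.inertiaDeg (𝓞 ℚ) = 1) (Q : (W.baseChange K).geomPrimaryTorsion p)
    (hQ : ∀ σ : absoluteGaloisGroup (𝔭.adicCompletion K),
      GaloisRep.restrictField (𝔭.adicCompletion K) (primaryGaloisModule (W.baseChange K) p) σ Q =
        Q) : Q = 0 := by
  have h := hE.fixedPoints_decomp_inf_kerSubgroup_eq_bot K κ 𝔭 h𝔭 he hf
  have hmem : Q ∈ FixedPoints.addSubgroup ↥(decomp 𝔭 ⊓ κ.kerSubgroup)
      ((W.baseChange K).geomPrimaryTorsion p) := by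
    refine (FixedPoints.mem_addSubgroup _ _ Q).mpr fun d ↦ ?_
    obtain ⟨σ, hσ⟩ := (mem_decomp_iff 𝔭 _).mp (Subgroup.mem_inf.mp d.2).1
    have h1 : absGaloisRestrict K (𝔭.adicCompletion K) σ • Q = Q := hQ σ
    rw [hσ] at h1
    exact h1
  rw [h] at hmem
  exact (AddSubgroup.mem_bot).mp hmem

/-- **(L10) at a datum of route R1** (JSW17 Lemma 3.3.3 on the constructed objects): for the
A′-hypotheses, an erratum field `K` for `q ≠ p`, a `ℤ_p`-extension `κ` with topological generator
`γ`, a degree-one `𝔭 ∋ p`, and `Sel_v(K, E[p^∞])` finite at every `v ∣ p` (clause one of (P6) at `𝔭`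
and `𝔭̄`): `CoinvariantsTrivialAt (W_K) p κ 𝔭 γ` — GIVEN the four cited cohomological facts.
[cite: JetchevSkinnerWan2017, Lemma 3.3.3 (arXiv:1512.06894 pp. 11–12)]
[cite: Castella2018, Thm. 2.3 (arXiv:1704.06608 p. 5)] -/
theorem coinvariantsTrivialAt_of_erratum (hE : ErratumHypotheses W p) {q : ℕ} {K : Type} [Field K]
    [NumberField K] (hPT : poitouTate_selmerStructure_duality K) (hPT2 : poitouTate_sha_tateDual K)
    (hEP : ∀ v : HeightOneSpectrum (𝓞 K), localEulerPoincareCharacteristic (v.adicCompletion K))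
    (hcd : fieldCdLE_two_of_numberField) (hK : IsErratumField W K q) (hqp : q ≠ p)
    (κ : ZpExtension K p) {γ : absoluteGaloisGroup K} (hγ : κ.IsTopGenerator γ)
    {𝔭 : HeightOneSpectrum (𝓞 K)} (h𝔭 : ((p : ℕ) : 𝓞 K) ∈ 𝔭.asIdeal)
    (he : 𝔭.asIdeal.ramificationIdx (𝓞 ℚ) = 1) (hf : 𝔭.asIdeal.inertiaDeg (𝓞 ℚ) = 1)
    (hfin : ∀ v : HeightOneSpectrum (𝓞 K), ((p : ℕ) : 𝓞 K) ∈ v.asIdeal →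
      Finite (selmerAcBase (W.baseChange K) p v ∅)) :
    CoinvariantsTrivialAt (W.baseChange K) p κ 𝔭 γ := by
  haveI : IsTotallyComplex K := hK.1.2
  have hpN : p ∣ W.conductorNorm ℤ := dvd_conductorNorm_of_mult hE.2.1
  have hsplit : SplitsIn K p := hK.2.2.1 p (Fact.out : p.Prime) hpN (Ne.symm hqp)
  obtain ⟨σ, 𝔮, -, hne, h𝔮, -⟩ :=
    LocalIndexTransport.exists_conj_prime_of_splitsIn K p hK.1.1 hsplit h𝔭
  have hΓ𝔭 := ErratumHypotheses.noInvariantsAt W p hE K κ 𝔭 h𝔭 he hf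
  have hΓ := Coinv.noInvariants_of_noInvariants_at (W.baseChange K) p hΓ𝔭
  have htor := exists_pow_nsmul_local_eq_zero W p hK.1.1 hsplit
  haveI := hfin 𝔭 h𝔭
  have h2 := WeakLeopoldt.subsingleton_galoisCohomology_two_primary (W.baseChange K) p 𝔭 ∅ hPT2
    (fieldCdLE_two_of_isTotallyComplex hcd K p) hΓ htor
  exact Coinv.coinvariantsTrivialAt_of_subsingleton (W.baseChange K) p κ hPT hEP h𝔭 h𝔮 hne hΓ𝔭
    (hfin 𝔮 h𝔮) h2 hγ

/-- **The two Poitou–Tate atoms (P6) ∧ (L10) at every datum from (P6) alone** and the four cited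
cohomological facts.
[cite: JetchevSkinnerWan2017, Prop. 3.2.1, Lemma 3.3.3 (arXiv:1512.06894 pp. 10–12)] -/
theorem r1TwoAtomsAt_of_baseSelmerCount
    (hPT : ∀ (K : Type) [Field K] [NumberField K], poitouTate_selmerStructure_duality K)
    (hPT2 : ∀ (K : Type) [Field K] [NumberField K], poitouTate_sha_tateDual K)
    (hEP : ∀ (K : Type) [Field K] [NumberField K] (v : HeightOneSpectrum (𝓞 K)),
      localEulerPoincareCharacteristic (v.adicCompletion K))
    (hcd : fieldCdLE_two_of_numberField) (h1 : R1BaseSelmerCountAt W p) : R1TwoAtomsAt W p := by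
  intro _ q _ K _ _ Dt H ι P hE hr hqp hmq hns hvq hK hCas hP hc hinf κ hκ γ _ 𝔭 h𝔭 he hf
  have h6 := h1 q K Dt H ι P hE hr hqp hmq hns hvq hK hCas hP hc hinf κ hκ γ 𝔭 h𝔭 he hf
  refine ⟨h6, ?_⟩
  have hpN : p ∣ W.conductorNorm ℤ := dvd_conductorNorm_of_mult hE.2.1
  have hsplit : SplitsIn K p := hK.2.2.1 p (Fact.out : p.Prime) hpN (Ne.symm hqp)
  have hfin : ∀ v : HeightOneSpectrum (𝓞 K), ((p : ℕ) : 𝓞 K) ∈ v.asIdeal →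
      Finite (selmerAcBase (W.baseChange K) p v ∅) := fun v hv ↦ by
    obtain ⟨he', hf'⟩ := degreeOne_of_splitsIn hK.1.1 hsplit hv
    obtain ⟨a, ⟨hfinv, -⟩, -⟩ :=
      h1 q K Dt H ι P hE hr hqp hmq hns hvq hK hCas hP hc hinf κ hκ γ v hv he' hf'
    exact hfinv
  exact coinvariantsTrivialAt_of_erratum W p hE (hPT K) (hPT2 K) (hEP K) hcd hK hqp κ
    (Fact.out : κ.IsTopGenerator γ) h𝔭 he hf hfin

end Atom

/-! ## §3. Statement of record: ONE typed Poitou–Tate shape -/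

section Record

variable (W : WeierstrassCurve ℚ) [W.IsElliptic] [W.IsGloballyMinimal] (p : ℕ) [Fact p.Prime]

/-- **Route R1 — statement of record, (P9) and (L10) eliminated.**  For every globally minimal
elliptic `W/ℚ` and prime `p` on `R1Population` with `ord_{s=1} L(E,s) = 1`: `BSD(E,p)`, from the
NINE PUBLISHED named facts of `R1.bsdp`, the FOUR CITED cohomological facts (Poitou–Tate duality for
Selmer structures, Howard 2.1.11 / Milne I 4.10 (b); Poitou–Tate duality of `Ш`, Harari 17.13 (b) /
Milne I 4.10 (a); local Euler–Poincaré characteristic, Milne I 2.8; `cd_p(Γ_K) ≤ 2`, Serre II §4.4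
Prop. 13), the ONE typed Poitou–Tate shape (P6) JSW17 Prop. 3.2.1/(7.1.5) at every datum, the local
shape (P11) Prop. 3.3.4 Case 1(a) on the pairs off the locally-trivial sub-population, and the ONE
OPEN input `R1OpenInputOnTreeAt` ((IMC)∘(BDP) at `𝟙`, PREPRINT).  Atoms (P9) Prop. 3.3.2 and (L10)
Lemma 3.3.3 are now tree theorems. CONDITIONAL; deletes nothing; X11b stays CONSTRUCTION-SHAPED; no
label change. [cite: Castella2018, §5 (arXiv:1704.06608 p. 12)]
[cite: Castella2018Erratum, Thm. 1.1, Thm. A′ (p. 1)]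
[cite: JetchevSkinnerWan2017, Thm. 3.3.1, Lemma 3.3.3 (arXiv:1512.06894 pp. 11–12)] -/
theorem R1.bsdp_of_onTree_oneAtom_facts
    (hGZ : GrossZagier1986_thm_I_7_3) (hGZK : rank_eq_analyticRank_of_analyticRank_le_one)
    (hSk : Skinner2016.thmC_padicValRat_bsd_rank_zero) (hmod : exists_isNewformOf)
    (hCST : CaiShuTian2014.thm11_trivialChar)
    (hFH : friedbergHoffstein_exists_twist_ne_zero_ramifiedAt)
    (hMaz : mazur_not_dvd_maninConstant_of_odd) (hNS : integral_neronScaling_of_isGloballyMinimal)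
    (hPT : ∀ (K : Type) [Field K] [NumberField K], poitouTate_selmerStructure_duality K)
    (hPT2 : ∀ (K : Type) [Field K] [NumberField K], poitouTate_sha_tateDual K)
    (hEP : ∀ (K : Type) [Field K] [NumberField K] (v : HeightOneSpectrum (𝓞 K)),
      localEulerPoincareCharacteristic (v.adicCompletion K))
    (hcd : fieldCdLE_two_of_numberField)
    (h1 : ∀ (W : WeierstrassCurve ℚ) [W.IsElliptic] [W.IsGloballyMinimal] (p : ℕ) [Fact p.Prime],
      R1BaseSelmerCountAt W p)
    (h11 : ∀ (W : WeierstrassCurve ℚ) [W.IsElliptic] [W.IsGloballyMinimal] (p : ℕ) [Fact p.Prime],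
      ¬ LocallyTrivialAt W p → R1LocalKernelOrderAt W p)
    (hA : ∀ (W : WeierstrassCurve ℚ) [W.IsElliptic] [W.IsGloballyMinimal] (p : ℕ) [Fact p.Prime],
      R1OpenInputOnTreeAt W p)
    (hW : R1Population W p) (hr : W.analyticRank = 1) : BSDp W p :=
  R1.bsdp_of_onTree_twoAtoms_facts W p hGZ hGZK hSk hmod hCST hFH hMaz hNS hPT hEP
    (fun W _ _ p _ ↦ r1TwoAtomsAt_of_baseSelmerCount W p hPT hPT2 hEP hcd (h1 W p)) h11 hA hW hr

end Record

end Summit.BirchSwinnertonDyer.Rank1Residual.X11b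

end
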